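import Literature.Algebra.Module.FreeOfFibreRankEq
import Mathlib.LinearAlgebra.Charpoly.BaseChange
import Mathlib.LinearAlgebra.Charpoly.ToMatrix
import HarnessLib

/-!
# One characteristic polynomial over a local domain, read in both fibres

Topic `Algebra/Module`; namespace `Literature.Algebra.Module`; a *proofs* file (theorems only, Mathlib + the tree's
`FreeOfFibreRankEq`).  Linear-algebra core of the «two-fibre comparison» of characteristic polynomials: let `R` be a
local domain with fraction field `K`, `R ↠ κ` a surjection onto a field, `M` a finite `R`-module with an endomorphism
`γ`, and suppose the two fibres `K ⊗_R M`, `κ ⊗_R M` are identified with vector spaces `V₁ / K`, `V₂ / κ` carrying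
endomorphisms `T₁`, `T₂` which are the conjugates of `γ ⊗ 1`.  If `dim_κ V₂ ≤ dim_K V₁` (e.g. both equal to one number
`g`), then `M` is free (`FreeOfFibreRankEq`) and **one monic polynomial `P = char(γ | M) ∈ R[X]` maps to `char(T₂)` under
`R → κ` and to `char(T₁)` under `R → K`** (`exists_monic_map_eq_charpoly_of_eq_conj`).

USE (cell `hodgecm-mathlib`, E2 line, P1-char (β2) integrator, A-p11): `R = 𝓞_{k,𝔓}`, `M` = the conormal module of
the zero section of a smooth proper model of an abelian variety `A`, `γ` = the conormal action of an extended
endomorphism, `V₁ = T_0^*(A)`, `V₂ = T_0^*(Ã)` (`cotangentFibreEquiv`, `cotangentMap_eq_conj` of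
`Motives/AbelianVarietyCotangentOfFibre(Endo)`), both of dimension `g = dim A = dim Ã`: Shimura's specialisation of
the cotangent characteristic polynomial ([Shimura1998] §12.4 Prop. 26 p. 109; §13.1).

## References
* G. Shimura, *Abelian Varieties with Complex Multiplication and Modular Functions* (1998), §12.4 Prop. 26 (proof,
  p. 109). [cite: Shimura1998, §12.4 Prop. 26 (proof p. 109)]
* H. Matsumura, *Commutative Ring Theory* (1986/1989), Thm. 2.3 and §7. [cite: Matsumura1987, Thm. 2.3 and §7]
-/

noncomputable section

open TensorProduct IsLocalRing Module Polynomial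

namespace Literature.Algebra.Module

variable (R : Type*) [CommRing R] [IsDomain R] [IsLocalRing R]
variable (K : Type*) [Field K] [Algebra R K] [IsFractionRing R K]
variable (κ : Type*) [Field κ] [Algebra R κ]
variable (M : Type*) [AddCommGroup M] [Module R M] [Module.Finite R M]
variable {V₁ : Type*} [AddCommGroup V₁] [Module K V₁]
variable {V₂ : Type*} [AddCommGroup V₂] [Module κ V₂]

/-- **Fibre identifications transfer the rank hypothesis**: if `K ⊗_R M ≃ V₁` and `κ ⊗_R M ≃ V₂` with
`dim_κ V₂ ≤ dim_K V₁`, then `M` is free over the local domain `R` (for `R ↠ κ`). [cite: Matsumura1987, Thm. 2.3 and §7] -/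
theorem free_of_fibreEquiv (hκ : Function.Surjective (algebraMap R κ))
    (Φ₁ : K ⊗[R] M ≃ₗ[K] V₁) (Φ₂ : κ ⊗[R] M ≃ₗ[κ] V₂) (hdim : finrank κ V₂ ≤ finrank K V₁) :
    Module.Free R M :=
  free_of_finrank_le_of_surjective R M K κ hκ (by rwa [Φ₁.finrank_eq, Φ₂.finrank_eq])

/-- Under the same hypotheses, `rank_R M = dim_K V₁ = dim_κ V₂`. [cite: Matsumura1987, Thm. 2.3 and §7] -/
theorem finrank_eq_of_fibreEquiv (hκ : Function.Surjective (algebraMap R κ))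
    (Φ₁ : K ⊗[R] M ≃ₗ[K] V₁) (Φ₂ : κ ⊗[R] M ≃ₗ[κ] V₂) (hdim : finrank κ V₂ ≤ finrank K V₁) :
    finrank R M = finrank K V₁ ∧ finrank K V₁ = finrank κ V₂ := by
  have h : finrank κ (κ ⊗[R] M) ≤ finrank K (K ⊗[R] M) := by rwa [Φ₁.finrank_eq, Φ₂.finrank_eq]
  have h1 := finrank_eq_finrank_tensor_of_le_of_surjective R M K κ hκ h
  have h2 := finrank_fractionRing_tensor_eq_of_le_of_surjective R M K κ hκ h
  rw [Φ₂.finrank_eq] at h1 h2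
  rw [Φ₁.finrank_eq] at h2
  exact ⟨h1.trans h2.symm, h2⟩

/-- **One monic polynomial over `R`, two characteristic polynomials.**  With `γ : M → M` over the local domain `R`,
fibre identifications `Φ₁ : K ⊗_R M ≃ V₁`, `Φ₂ : κ ⊗_R M ≃ V₂` (`R ↠ κ`, `K = Frac R`) under which `T₁`, `T₂` are the
conjugates of `γ ⊗ 1`, and `dim_κ V₂ ≤ dim_K V₁`: the monic `P := char(γ | M) ∈ R[X]` satisfies `P^{R→κ} = char T₂` and
`P^{R→K} = char T₁` (Shimura's specialisation of the cotangent characteristic polynomial).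
[cite: Shimura1998, §12.4 Prop. 26 (proof p. 109)] -/
theorem exists_monic_map_eq_charpoly_of_eq_conj [FiniteDimensional K V₁] [FiniteDimensional κ V₂]
    (hκ : Function.Surjective (algebraMap R κ)) (γ : M →ₗ[R] M)
    (Φ₁ : K ⊗[R] M ≃ₗ[K] V₁) (T₁ : V₁ →ₗ[K] V₁) (h₁ : T₁ = Φ₁.conj (γ.baseChange K))
    (Φ₂ : κ ⊗[R] M ≃ₗ[κ] V₂) (T₂ : V₂ →ₗ[κ] V₂) (h₂ : T₂ = Φ₂.conj (γ.baseChange κ))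
    (hdim : finrank κ V₂ ≤ finrank K V₁) :
    ∃ P : R[X], P.Monic ∧ P.map (algebraMap R κ) = T₂.charpoly ∧ P.map (algebraMap R K) = T₁.charpoly := by
  haveI : Module.Free R M := free_of_fibreEquiv R K κ M hκ Φ₁ Φ₂ hdim
  refine ⟨γ.charpoly, γ.charpoly_monic, ?_, ?_⟩
  · rw [h₂, LinearEquiv.charpoly_conj, LinearMap.charpoly_baseChange]
  · rw [h₁, LinearEquiv.charpoly_conj, LinearMap.charpoly_baseChange]

end Literature.Algebra.Module

end
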